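import Literature.NumberTheory.EllipticCurves.TwoDescentHalvingGeometric
import HarnessLib

/-!
# The `2`-descent map is the Kummer map: `kummerEquiv ∘ H¹(χ₁) ∘ κ = twoDescentComponent`

Silverman, *The Arithmetic of Elliptic Curves*, 2nd ed., Prop. X.1.4 (Complete `2`-descent) is
deduced there from Thm. X.1.1: for an elliptic curve `E/K` (`char K = 0`) with rational `2`-torsion
`e₁, e₂, e₃`, the connecting homomorphism `κ : E(K) → H¹(K, E[2])` of the Kummer sequence (tree
`kummerMapTorsion`, `KummerMap.lean`), paired with `T₁` through `χ₁ = e₂(·, T₁) : E[2] → μ₂`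
(`TwoDescentTwoTorsionCharacter.lean`) and read through Kummer theory `H¹(K, μ₂) ≃ Kˣ/Kˣ²` (tree
`kummerEquiv`), is `P ↦ x(P) - e₁` modulo squares. The tree had the elementary algebraic half of
Prop. X.1.4 (`TwoDescent.lean`: `twoDescentComponent`, a homomorphism with kernel `2E(K)`) and,
separately, the cohomological Selmer group `Sel⁽²⁾(E/K) ⊆ H¹(K, E[2])` (`Selmer.lean`) — but no
bridge between them. This file is that bridge:

* `twoTorsionCharH1_kummerClassTorsion`: `H¹(χ₁)[σ ↦ σQ - Q] = [σ ↦ σ(α)/α]` whenever the cocycles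
  agree pointwise;
* `twoTorsionCharH1_kummerMapTorsion_of_ne` / `_of_eq` / `_zero`: `H¹(χ₁)(κ P)` is the Kummer class
  (`kummerMap K 2`) of `x(P) - e₁` for `x(P) ≠ e₁`, of `(e₁ - e₂)(e₁ - e₃)` at `T₁`, of `1` at `O`
  (computed on the explicit halving point `geomHalving`, whose Galois conjugates are controlled by
  `TwoDescentHalvingGeometric.lean`);
* **`kummerEquiv_twoTorsionCharH1_kummerMapTorsion`**: for every `P ∈ E(K)`,
  `kummerEquiv K 2 (H¹(χ₁)(κ P)) = twoDescentComponent W e₁ e₂ e₃ P` — the `T₁`-component of the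
  complete `2`-descent map; the `T₂`-component is the same statement for `h.swap₁₂`.

All statements hold over any field `K` of characteristic `0`, hence verbatim over the completions
`ℚ_v`: together with the injectivity of `(H¹(χ₁), H¹(χ₂))` this identifies, place by place, the
image of the local Kummer map `E(K_v)/2 → H¹(K_v, E[2])` with the image of the classical descent map
`E(K_v) → (K_vˣ/K_vˣ²)²`; the global assembly (unramified classes, `K(S, 2)`, `#Sel⁽²⁾(E_{2pq}) ≤ 8`)
is left to a sequel. Theorems only; no named fact. Cell `bsd-monsky`.

## References

* [SilvermanAEC2009] J. H. Silverman, *The Arithmetic of Elliptic Curves*, 2nd ed., GTM 106,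
  Springer 2009, Thm. X.1.1, Prop. X.1.4, VIII.§2, X.§4.
* [SerreGaloisCohomology1997] J.-P. Serre, *Galois Cohomology*, Springer 1997, I.§2.4, II.§1.2.
-/

noncomputable section

open scoped Classical

universe u



namespace WeierstrassCurve

open Literature.NumberTheory.GaloisRepresentations Literature.NumberTheory.EllipticCurves Field
open WeierstrassCurve.Affine

variable {K : Type u} [Field K] [CharZero K] (W : WeierstrassCurve K) [W.IsElliptic] {e₁ e₂ e₃ : K}


/-! ### The main identity: `H¹(χ₁) ∘ κ` is the `2`-descent component `x - e₁` -/

/-- **`H¹(χ₁)` of a Kummer class is a Kummer class of `μ₂`**, whenever the two cocycles agree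
pointwise: if `χ₁(σQ - Q) = σ(α)/α` for all `σ` then `H¹(χ₁)[σ ↦ σQ - Q] = [σ ↦ σ(α)/α]`.
[cite: SerreGaloisCohomology1997, I.§2.4] -/
theorem twoTorsionCharH1_kummerClassTorsion (h : W.toAffine.SplitTwoTorsion e₁ e₂ e₃)
    (Q : geomPoints W)
    (hQ : (2 : ℤ) • Q ∈ MulAction.fixedPoints (absoluteGaloisGroup K) (geomPoints W))
    (α : kummerUnits K 2)
    (hval : ∀ σ : absoluteGaloisGroup K,
      muVal K 2 (W.twoTorsionChar h ⟨σ • Q - Q, smul_sub_mem_geomTorsion hQ σ⟩) =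
        σ • (α : (AlgebraicClosure K)ˣ) / α) :
    W.twoTorsionCharH1 h (kummerClassTorsion W 2 Q hQ) = (kummerClassHom K 2 α).toAdd := by
  unfold kummerClassTorsion
  rw [twoTorsionCharH1_oneCocycleClass, kummerClassHom_apply, toAdd_ofAdd]
  congr 1
  apply Subtype.ext
  ext σ
  apply muVal_injective K 2
  rw [kummerOneCocycle_apply, muVal_kummerOneCocycleFun]
  exact hval σ

/-- **The `2`-descent map is the Kummer map, generic point** (Silverman AEC Thm. X.1.1 + Prop. X.1.4):
for `P = (x₀, y₀) ∈ E(K)` with `x₀ ≠ e₁`, `H¹(χ₁)(κ(P)) ∈ H¹(K, μ₂)` is the Kummer class of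
`x₀ - e₁ ∈ Kˣ` (`κ = kummerMapTorsion`, the connecting homomorphism `E(K) → H¹(K, E[2])`, computed on
the explicit halving point `Q(u)`; `χ₁(σQ - Q) = σ(u₁)/u₁` with `u₁ = √(x₀ - e₁)`).
[cite: SilvermanAEC2009, Thm. X.1.1, Prop. X.1.4] -/
theorem twoTorsionCharH1_kummerMapTorsion_of_ne (h : W.toAffine.SplitTwoTorsion e₁ e₂ e₃)
    (hdiv : ∀ P : geomPoints W, ∃ Q : geomPoints W, (2 : ℤ) • Q = P) {x₀ y₀ : K}
    (h₀ : W.toAffine.Nonsingular x₀ y₀) (hx : x₀ ≠ e₁) :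
    W.twoTorsionCharH1 h (kummerMapTorsion W 2 hdiv (Affine.Point.some x₀ y₀ h₀)) =
      (kummerMap K 2 (Units.mk0 (x₀ - e₁) (sub_ne_zero.mpr hx))).toAdd := by
  haveI := W.isElliptic_baseChange (AlgebraicClosure K)
  -- the halving data over `K̄`
  have h₀' : (W.baseChange (AlgebraicClosure K)).toAffine.Nonsingular
      (algebraMap K (AlgebraicClosure K) x₀) (algebraMap K (AlgebraicClosure K) y₀) :=
    (Affine.map_nonsingular (W := W.toAffine) (algebraMap K (AlgebraicClosure K)).injective x₀
      y₀).mpr h₀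
  obtain ⟨u₁, u₂, u₃, hu₁, hu₂, hu₃, hy⟩ :=
    Affine.Point.exists_halving_roots (h.map (AlgebraicClosure K)) h₀'.1
  have hy' : algebraMap K (AlgebraicClosure K) (y₀ + (W.a₁ * x₀ + W.a₃) / 2) = u₁ * u₂ * u₃ := by
    rw [← hy]
    simp only [map_add, map_div₀, map_mul, map_ofNat, baseChange, map_a₁, map_a₃]
  have hu₁0 : u₁ ≠ 0 := by
    intro h0
    rw [h0, zero_pow two_ne_zero, sub_eq_zero] at hu₁
    exact hx ((algebraMap K (AlgebraicClosure K)).injective hu₁)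
  -- the Kummer unit `u₁`
  have hα : Units.mk0 u₁ hu₁0 ∈ kummerUnits K 2 := by
    intro σ
    ext
    rw [Units.coe_smul, Units.val_pow_eq_pow_val, Units.val_mk0, ← hu₁, ← map_sub]
    exact (show AlgebraicClosure K ≃ₐ[K] AlgebraicClosure K from σ).commutes _
  set α : kummerUnits K 2 := ⟨Units.mk0 u₁ hu₁0, hα⟩ with hαdef
  -- the Kummer map at `x₀ - e₁` is the Kummer class of `u₁`
  have hroot : kummerMap K 2 (Units.mk0 (x₀ - e₁) (sub_ne_zero.mpr hx)) = kummerClassHom K 2 α := by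
    rw [kummerMap_apply]
    apply kummerClassHom_eq_of_pow_eq
    rw [kummerUnitsRoot_pow]
    ext
    rw [Units.coe_map, MonoidHom.coe_coe, Units.val_mk0, hαdef, Units.val_pow_eq_pow_val,
      Units.val_mk0, ← hu₁, map_sub]
  have hQ2 := W.two_zsmul_geomHalving h h₀ hu₁ hu₂ hu₃ hy'
  have hQfix : (2 : ℤ) • W.geomHalving h hu₁ hu₂ hu₃ ∈
      MulAction.fixedPoints (absoluteGaloisGroup K) (geomPoints W) := by
    rw [hQ2]; exact toGeomPoints_mem_fixedPoints W _
  rw [hroot, kummerMapTorsion_apply, kummerMapTorsionFun_eq W 2 hdiv _ _ hQ2]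
  refine W.twoTorsionCharH1_kummerClassTorsion h _ hQfix α fun σ => ?_
  obtain ⟨s, -, hs, hs₁, -⟩ := W.exists_sign_muVal_twoTorsionChar_smul_geomHalving_sub h σ hu₁ hu₂ hu₃
    hy' (smul_sub_mem_geomTorsion hQfix σ)
  ext
  rw [hs, Units.val_div_eq_div_val, Units.coe_smul, hαdef, Units.val_mk0, hs₁,
    mul_div_cancel_right₀ _ hu₁0]


/-- **The `2`-descent map is the Kummer map at `T₁`**: for `P = (e₁, y₀)` (necessarily `T₁`),
`H¹(χ₁)(κ(P))` is the Kummer class of `(e₁ - e₂)(e₁ - e₃)` (the halving point has `u₁ = 0`, and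
`χ₁(σQ - Q) = σ(u₂u₃)/(u₂u₃)` with `(u₂u₃)² = (e₁ - e₂)(e₁ - e₃)`).
[cite: SilvermanAEC2009, Thm. X.1.1, Prop. X.1.4] -/
theorem twoTorsionCharH1_kummerMapTorsion_of_eq (h : W.toAffine.SplitTwoTorsion e₁ e₂ e₃)
    (hdiv : ∀ P : geomPoints W, ∃ Q : geomPoints W, (2 : ℤ) • Q = P) {x₀ y₀ : K}
    (h₀ : W.toAffine.Nonsingular x₀ y₀) (hx : x₀ = e₁) :
    W.twoTorsionCharH1 h (kummerMapTorsion W 2 hdiv (Affine.Point.some x₀ y₀ h₀)) =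
      (kummerMap K 2 (Units.mk0 ((e₁ - e₂) * (e₁ - e₃)) h.c_ne_zero)).toAdd := by
  haveI := W.isElliptic_baseChange (AlgebraicClosure K)
  subst hx
  have h₀' : (W.baseChange (AlgebraicClosure K)).toAffine.Nonsingular
      (algebraMap K (AlgebraicClosure K) x₀) (algebraMap K (AlgebraicClosure K) y₀) :=
    (Affine.map_nonsingular (W := W.toAffine) (algebraMap K (AlgebraicClosure K)).injective x₀
      y₀).mpr h₀
  obtain ⟨u₁, u₂, u₃, hu₁, hu₂, hu₃, hy⟩ :=
    Affine.Point.exists_halving_roots (h.map (AlgebraicClosure K)) h₀'.1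
  have hy' : algebraMap K (AlgebraicClosure K) (y₀ + (W.a₁ * x₀ + W.a₃) / 2) = u₁ * u₂ * u₃ := by
    rw [← hy]
    simp only [map_add, map_div₀, map_mul, map_ofNat, baseChange, map_a₁, map_a₃]
  have hu₂0 : u₂ ≠ 0 := by
    intro h0
    rw [h0, zero_pow two_ne_zero, sub_eq_zero] at hu₂
    exact h.ne₁₂ ((algebraMap K (AlgebraicClosure K)).injective hu₂)
  have hu₃0 : u₃ ≠ 0 := by
    intro h0
    rw [h0, zero_pow two_ne_zero, sub_eq_zero] at hu₃
    exact h.ne₁₃ ((algebraMap K (AlgebraicClosure K)).injective hu₃)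
  have hu0 : u₂ * u₃ ≠ 0 := mul_ne_zero hu₂0 hu₃0
  have hsq : (u₂ * u₃) ^ 2 = algebraMap K (AlgebraicClosure K) ((x₀ - e₂) * (x₀ - e₃)) := by
    rw [mul_pow, ← hu₂, ← hu₃, map_mul, map_sub, map_sub]
  -- the Kummer unit `u₂u₃`
  have hα : Units.mk0 (u₂ * u₃) hu0 ∈ kummerUnits K 2 := by
    intro σ
    ext
    rw [Units.coe_smul, Units.val_pow_eq_pow_val, Units.val_mk0, hsq]
    exact (show AlgebraicClosure K ≃ₐ[K] AlgebraicClosure K from σ).commutes _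
  set α : kummerUnits K 2 := ⟨Units.mk0 (u₂ * u₃) hu0, hα⟩ with hαdef
  have hroot : kummerMap K 2 (Units.mk0 ((x₀ - e₂) * (x₀ - e₃)) h.c_ne_zero) =
      kummerClassHom K 2 α := by
    rw [kummerMap_apply]
    apply kummerClassHom_eq_of_pow_eq
    rw [kummerUnitsRoot_pow]
    ext
    rw [Units.coe_map, MonoidHom.coe_coe, Units.val_mk0, hαdef, Units.val_pow_eq_pow_val,
      Units.val_mk0, hsq]
  have hQ2 := W.two_zsmul_geomHalving h h₀ hu₁ hu₂ hu₃ hy'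
  have hQfix : (2 : ℤ) • W.geomHalving h hu₁ hu₂ hu₃ ∈
      MulAction.fixedPoints (absoluteGaloisGroup K) (geomPoints W) := by
    rw [hQ2]; exact toGeomPoints_mem_fixedPoints W _
  rw [hroot, kummerMapTorsion_apply, kummerMapTorsionFun_eq W 2 hdiv _ _ hQ2]
  refine W.twoTorsionCharH1_kummerClassTorsion h _ hQfix α fun σ => ?_
  obtain ⟨s, -, hs, -, hs₂⟩ := W.exists_sign_muVal_twoTorsionChar_smul_geomHalving_sub h σ hu₁ hu₂ hu₃
    hy' (smul_sub_mem_geomTorsion hQfix σ)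
  ext
  rw [hs, Units.val_div_eq_div_val, Units.coe_smul, hαdef, Units.val_mk0, hs₂,
    mul_div_cancel_right₀ _ hu0]

/-- **The `2`-descent map is the Kummer map at `O`** (both vanish). [cite: SilvermanAEC2009, Prop. X.1.4] -/
theorem twoTorsionCharH1_kummerMapTorsion_zero (h : W.toAffine.SplitTwoTorsion e₁ e₂ e₃)
    (hdiv : ∀ P : geomPoints W, ∃ Q : geomPoints W, (2 : ℤ) • Q = P) :
    W.twoTorsionCharH1 h (kummerMapTorsion W 2 hdiv 0) = (kummerMap K 2 1).toAdd := by
  rw [map_zero, map_zero, map_one]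
  rfl

/-- **THE `2`-DESCENT MAP IS THE KUMMER MAP** (Silverman AEC Prop. X.1.4 from Thm. X.1.1): for every
`P ∈ E(K)`, the image of the Kummer class `κ(P) ∈ H¹(K, E[2])` under `H¹(χ₁)` followed by Kummer
theory `H¹(K, μ₂) ≃ Kˣ/Kˣ²` is the `T₁`-component `twoDescentComponent` of the complete `2`-descent
map: `x(P) - e₁` for `x(P) ≠ e₁`, `(e₁ - e₂)(e₁ - e₃)` at `T₁`, `1` at `O` (modulo squares).
[cite: SilvermanAEC2009, Thm. X.1.1, Prop. X.1.4] -/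
theorem kummerEquiv_twoTorsionCharH1_kummerMapTorsion (h : W.toAffine.SplitTwoTorsion e₁ e₂ e₃)
    (hdiv : ∀ P : geomPoints W, ∃ Q : geomPoints W, (2 : ℤ) • Q = P) (P : W.toAffine.Point) :
    kummerEquiv K 2 (W.twoTorsionCharH1 h (kummerMapTorsion W 2 hdiv P)) =
      Additive.ofMul (Affine.Point.twoDescentComponent W.toAffine e₁ e₂ e₃ P) := by
  rcases P with _ | ⟨x₀, y₀, h₀⟩
  · rw [← Affine.Point.zero_def, W.twoTorsionCharH1_kummerMapTorsion_zero h hdiv,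
      kummerEquiv_kummerMap, Affine.Point.twoDescentComponent_zero, QuotientGroup.mk_one]
  · by_cases hx : x₀ = e₁
    · rw [W.twoTorsionCharH1_kummerMapTorsion_of_eq h hdiv h₀ hx, kummerEquiv_kummerMap,
        Affine.Point.twoDescentComponent_some_of_eq _ hx, Affine.sqClass_of_ne_zero h.c_ne_zero]
    · rw [W.twoTorsionCharH1_kummerMapTorsion_of_ne h hdiv h₀ hx, kummerEquiv_kummerMap,
        Affine.Point.twoDescentComponent_some_of_ne _ hx,
        Affine.sqClass_of_ne_zero (sub_ne_zero.mpr hx)]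


end WeierstrassCurve

end
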